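import Literature.Probability.RandomPlanarGeometry.HexSAW
import HarnessLib

/-!
# Tip patterns of a hexagonal-lattice walk (definition request `defn-HexTipPattern`)

Topic `Literature/Probability/RandomPlanarGeometry`, next to `HexSAW.lean` (the tree's
`SAWKestenPatterns.lean` is `ℤ^d`-specific). For a walk `γ` of (a subgraph of) the hexagonal lattice
`Literature.Probability.LatticeModels.hexGraph` (vertices `HexVertex = Site 2 × Fin 2`: a cell
`x ∈ ℤ²` and a sublattice class, embedded by `hexCenter`), a radius `r : ℕ` and a time `t`, the
**radius-`r` tip pattern** `hexTipPattern γ r t` records, in coordinates relative to the tip `γ_t`: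

* the sublattice class of `γ_t`, and
* for every dart `(γ_s, γ_{s+1})`, `s < t`, both of whose endpoints lie within triangular-norm
  distance `r` of `γ_t` (`triNorm` of the difference of cells): the relative cell and class of `γ_s`,
  the relative cell and class of `γ_{s+1}`, and the winding of the walk from dart `s` to the last dart
  before the tip, `Σ_{s ≤ j < t-1} turn_j ∈ ℤ` in units of `π/3`, where `turn_j = ±1` is the sign of
  `Im(conj(u_j) · u_{j+1})` for the dart vectors `u_j = hexCenter γ_{j+1} - hexCenter γ_j`
  (`hexDartVec`, `hexTurn`; on the honeycomb lattice consecutive darts always turn by `±π/3`);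

and `tipPatternFreq γ r Q = #{t < length γ : hexTipPattern γ r t = Q} / length γ` is the occurrence
frequency of the pattern `Q` along `γ`. These are, packaged as definitions, exactly the `pat` /
frequency `let`s of the route item `SAWTurnDefect.TipPatternEquilibrium`
(stmt-CriticalPhenomena-7892; `hexTipPattern_getVert` unfolds `hexTipPattern γ.walk r t` to that
`let`-expression), the growing-tip analogue of the front/tail patterns of Madras–Slade (*The
Self-Avoiding Walk* (1993), Def. 7.1.2, §7.4) and of Kesten's patterns (1963); also meant for the
informal crux `KernelOrthogonality` (stmt-CriticalPhenomena-8295). The construction is route-specific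
(no published source defines this exact object), hence tagged `[folklore]`.

API (all proved): the pattern depends only on the vertex sequence (`hexTipPatternOfSeq`,
`hexTipPattern`), translation invariance in the cell coordinate (`hexCenter_add_left`,
`hexDartVec_translate`, `hexTurn_translate`, `hexTipPatternOfSeq_translate`), restriction to a
smaller radius (`tipPatternRestrict`, `hexTipPatternOfSeq_restrict`, `hexTipPattern_restrict`), and
`Σ_Q tipPatternFreq γ r Q = 1` over the realised patterns (`sum_tipPatternFreq`). Measurability is
automatic: the SAW types of `HexSAW.lean` carry the discrete σ-algebra `⊤`. NOT provided (false as
stated in the request): finiteness of the set of realisable radius-`r` patterns — the recorded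
windings are unbounded (spirals), so for fixed `r ≥ 1` infinitely many patterns occur.

## References

* N. Madras, G. Slade, *The Self-Avoiding Walk*, Birkhäuser (1993), Def. 7.1.2, §7.4 (patterns,
  front/tail patterns). [`MadrasSlade1993`]
* H. Kesten, *On the number of self-avoiding walks*, J. Math. Phys. 4 (1963) 960–969 (Kesten's
  pattern theorem).
-/

noncomputable section

namespace Literature.Probability.RandomPlanarGeometry

open Finset
open Literature.Probability.LatticeModels (Site HexVertex hexCenter triNorm triEmbed triEmbed_add)

/-- The type of radius-`r` **tip patterns**: a sublattice class (of the tip) and a finite set of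
recorded darts `(relative cell of γ_s, class of γ_s, relative cell of γ_{s+1}, class of γ_{s+1},
winding from dart s to the last dart, in units of π/3)`. [folklore] -/
abbrev HexTipPatternType : Type :=
  Fin 2 × Finset (Site 2 × Fin 2 × Site 2 × Fin 2 × ℤ)

/-- The `s`-th **dart vector** of a vertex sequence: `u_s = hexCenter γ_{s+1} - hexCenter γ_s`. [folklore] -/
def hexDartVec (pt : ℕ → HexVertex) (s : ℕ) : ℂ :=
  hexCenter (pt (s + 1)) - hexCenter (pt s)

/-- The `j`-th **turn** `turn_j = ±1`: the sign of `Im(conj(u_j) · u_{j+1})` (left turn `+1`, right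
turn `-1`; on the honeycomb lattice consecutive darts of a walk turn by `±π/3`). The value `-1` is
also returned in the degenerate case `Im = 0` (never a walk). [folklore] -/
def hexTurn (pt : ℕ → HexVertex) (j : ℕ) : ℤ :=
  if 0 < ((starRingEnd ℂ) (hexDartVec pt j) * hexDartVec pt (j + 1)).im then 1 else -1

/-- The radius-`r` **tip pattern at time `t` of a vertex sequence** `pt : ℕ → HexVertex`: the class of
`pt t` and, over the darts `s < t` with `triNorm ((pt s).1 - (pt t).1) ≤ r` and
`triNorm ((pt (s+1)).1 - (pt t).1) ≤ r`, the tuple (relative cell and class of `pt s`, relative cell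
and class of `pt (s+1)`, winding `Σ_{j ∈ [s, t-1)} turn_j`). [folklore] -/
def hexTipPatternOfSeq (pt : ℕ → HexVertex) (r t : ℕ) : HexTipPatternType :=
  ((pt t).2,
    ((range t).filter fun s =>
        triNorm ((pt s).1 - (pt t).1) ≤ r ∧ triNorm ((pt (s + 1)).1 - (pt t).1) ≤ r).image
      fun s => ((pt s).1 - (pt t).1, (pt s).2, (pt (s + 1)).1 - (pt t).1, (pt (s + 1)).2,
        ∑ j ∈ Ico s (t - 1), hexTurn pt j))

/-- The radius-`r` **tip pattern** `hexTipPattern γ r t` of a walk `γ` in any graph on `HexVertex`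
(the hexagonal lattice `hexGraph` or one of its domain subgraphs `embDomainGraph hexGraph hexCenter Ω δ`
of `HexSAW.lean`) at time `t`: `hexTipPatternOfSeq` of its vertex sequence `s ↦ γ.getVert s`
(constant `= γ_{length}` after the end). [folklore] -/
def hexTipPattern {G : SimpleGraph HexVertex} {a b : HexVertex} (p : G.Walk a b) (r t : ℕ) :
    HexTipPatternType :=
  hexTipPatternOfSeq (fun s => p.getVert s) r t

open scoped Classical in
/-- The **occurrence frequency** of the radius-`r` pattern `Q` along the walk `γ`:
`#{t < length γ : hexTipPattern γ r t = Q} / length γ` (junk `0` for the trivial walk, `0/0 = 0`).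
Equality of patterns is decided classically (as in the route item, elaborated under
`open scoped Classical`; instance search does not find `DecidableEq` for finsets of tuples
containing `Site 2 = Fin 2 → ℤ`). [folklore] -/
def tipPatternFreq {G : SimpleGraph HexVertex} {a b : HexVertex} (p : G.Walk a b) (r : ℕ)
    (Q : HexTipPatternType) : ℝ :=
  (((range p.length).filter fun t => hexTipPattern p r t = Q).card : ℝ) / p.length

/-! ### Unfolding -/

/-- `hexTipPattern γ r t` is literally the `let`-expression `pat t` of route item
`SAWTurnDefect.TipPatternEquilibrium` (stmt-CriticalPhenomena-7892) with `pt s := γ.getVert s`,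
`u s := hexCenter (pt (s+1)) - hexCenter (pt s)`,
`turn j := if 0 < (conj (u j) * u (j+1)).im then 1 else -1`. [folklore] -/
theorem hexTipPattern_getVert {G : SimpleGraph HexVertex} {a b : HexVertex} (p : G.Walk a b)
    (r t : ℕ) :
    hexTipPattern p r t =
      (let pt : ℕ → HexVertex := fun s => p.getVert s
       let u : ℕ → ℂ := fun s => hexCenter (pt (s + 1)) - hexCenter (pt s)
       let turn : ℕ → ℤ := fun j => if 0 < ((starRingEnd ℂ) (u j) * u (j + 1)).im then 1 else -1
       ((pt t).2, ((range t).filter (fun s => triNorm ((pt s).1 - (pt t).1) ≤ r ∧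
          triNorm ((pt (s + 1)).1 - (pt t).1) ≤ r)).image (fun s => ((pt s).1 - (pt t).1, (pt s).2,
            (pt (s + 1)).1 - (pt t).1, (pt (s + 1)).2, ∑ j ∈ Ico s (t - 1), turn j)))) :=
  rfl

open scoped Classical in
/-- `tipPatternFreq` unfolded. [folklore] -/
theorem tipPatternFreq_eq {G : SimpleGraph HexVertex} {a b : HexVertex} (p : G.Walk a b) (r : ℕ)
    (Q : HexTipPatternType) :
    tipPatternFreq p r Q =
      (((range p.length).filter fun t => hexTipPattern p r t = Q).card : ℝ) / p.length :=
  rfl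

/-! ### Translation invariance -/

/-- `hexCenter` is equivariant under cell translations: `hexCenter (x + v, c) = hexCenter (x, c) + triEmbed v`. [folklore] -/
theorem hexCenter_add_left (x v : Site 2) (c : Fin 2) :
    hexCenter (x + v, c) = hexCenter (x, c) + triEmbed v := by
  simp only [hexCenter, triEmbed_add]
  ring

/-- Dart vectors are invariant under translating every cell by `v`. [folklore] -/
theorem hexDartVec_translate (pt : ℕ → HexVertex) (v : Site 2) :
    hexDartVec (fun s => ((pt s).1 + v, (pt s).2)) = hexDartVec pt := by
  funext s
  simp only [hexDartVec, hexCenter_add_left]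
  ring

/-- Turns are invariant under translating every cell by `v`. [folklore] -/
theorem hexTurn_translate (pt : ℕ → HexVertex) (v : Site 2) :
    hexTurn (fun s => ((pt s).1 + v, (pt s).2)) = hexTurn pt := by
  funext j
  simp only [hexTurn, hexDartVec_translate]

/-- **Translation invariance** of tip patterns: translating every cell of the vertex sequence by
`v ∈ ℤ²` (keeping the classes) does not change any tip pattern. [folklore] -/
theorem hexTipPatternOfSeq_translate (pt : ℕ → HexVertex) (v : Site 2) (r t : ℕ) :
    hexTipPatternOfSeq (fun s => ((pt s).1 + v, (pt s).2)) r t = hexTipPatternOfSeq pt r t := by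
  simp only [hexTipPatternOfSeq, hexTurn_translate, add_sub_add_right_eq_sub]

/-! ### Restriction to a smaller radius -/

/-- Restriction of a pattern to radius `r'`: keep the recorded darts whose two relative cells have
`triNorm ≤ r'`. [folklore] -/
def tipPatternRestrict (r' : ℕ) (Q : HexTipPatternType) : HexTipPatternType :=
  (Q.1, Q.2.filter fun e => triNorm e.1 ≤ r' ∧ triNorm e.2.2.1 ≤ r')

/-- **Restriction maps**: for `r' ≤ r` the radius-`r'` pattern is the restriction of the radius-`r`
pattern (vertex-sequence form). [folklore] -/
theorem hexTipPatternOfSeq_restrict (pt : ℕ → HexVertex) {r' r : ℕ} (h : r' ≤ r) (t : ℕ) :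
    hexTipPatternOfSeq pt r' t = tipPatternRestrict r' (hexTipPatternOfSeq pt r t) := by
  have h' : (r' : ℤ) ≤ r := by exact_mod_cast h
  simp only [hexTipPatternOfSeq, tipPatternRestrict, Prod.mk.injEq, true_and]
  rw [Finset.filter_image, Finset.filter_filter]
  congr 1
  apply Finset.filter_congr
  intro s _
  constructor
  · rintro ⟨h1, h2⟩
    exact ⟨⟨h1.trans h', h2.trans h'⟩, h1, h2⟩
  · rintro ⟨-, h1, h2⟩
    exact ⟨h1, h2⟩

/-- **Restriction maps** for walks: for `r' ≤ r`,
`hexTipPattern γ r' t = tipPatternRestrict r' (hexTipPattern γ r t)`. [folklore] -/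
theorem hexTipPattern_restrict {G : SimpleGraph HexVertex} {a b : HexVertex} (p : G.Walk a b)
    {r' r : ℕ} (h : r' ≤ r) (t : ℕ) :
    hexTipPattern p r' t = tipPatternRestrict r' (hexTipPattern p r t) :=
  hexTipPatternOfSeq_restrict _ h t

/-! ### Frequencies sum to one -/

open scoped Classical in
/-- **`Σ_Q tipPatternFreq γ r Q = 1`**, the sum running over the patterns realised along `γ` (all
other patterns have frequency `0`), for a walk of positive length. [folklore] -/
theorem sum_tipPatternFreq {G : SimpleGraph HexVertex} {a b : HexVertex} (p : G.Walk a b) (r : ℕ)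
    (hp : p.length ≠ 0) :
    ∑ Q ∈ (range p.length).image (hexTipPattern p r), tipPatternFreq p r Q = 1 := by
  simp only [tipPatternFreq]
  rw [← Finset.sum_div, ← Nat.cast_sum]
  have hnat : (∑ Q ∈ (range p.length).image (hexTipPattern p r),
      ((range p.length).filter fun t => hexTipPattern p r t = Q).card) = p.length := by
    have h := Finset.card_eq_sum_card_image (hexTipPattern p r) (range p.length)
    rw [card_range] at h
    convert h.symm using 2
  rw [hnat]
  exact div_self (by exact_mod_cast hp)

open scoped Classical in
/-- Patterns not realised along `γ` have frequency `0`. [folklore] -/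
theorem tipPatternFreq_eq_zero_of_not_mem {G : SimpleGraph HexVertex} {a b : HexVertex}
    (p : G.Walk a b) (r : ℕ) {Q : HexTipPatternType}
    (hQ : Q ∉ (range p.length).image (hexTipPattern p r)) : tipPatternFreq p r Q = 0 := by
  rw [tipPatternFreq, Finset.filter_eq_empty_iff.mpr, card_empty, Nat.cast_zero, zero_div]
  intro t ht h
  exact hQ (Finset.mem_image.mpr ⟨t, ht, h⟩)

end Literature.Probability.RandomPlanarGeometry
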